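import Literature.MathematicalPhysics.QuantumFieldTheory.Balaban1983to89.B9Eq326DeltaABlockDecayTowerClosedRadius
import Literature.MathematicalPhysics.QuantumFieldTheory.Balaban1983to89.B9Eq3126H1RowLettersDiagonalClosed

/-!
# `Balaban1983to89.B9Eq326DeltaABlockDecayTowerDiagonalClosed` — T. Bałaban, *Propagators for lattice gauge theories in a background field*, Commun. Math. Phys.
# **99** (1985) 389–434 [Balaban1985BackgroundPropagators] (3.26) p. 395, Thm 3.11 p. 416, (3.79) p. 406, (3.49) p. 399 («|G(b, c)| ≤ O(1)e^{−δ₀ d(b,c)}»,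
# constants «independent of the field configuration» and of the step), (3.35)–(3.37) p. 396: **THE `L²` BLOCK DECAY OF THE BOND PROPAGATOR `G₁,k(U) =
# Δ_{a,k}(U)⁻¹` ON PRINT's DIAGONAL, FULLY CLOSED — `∃ α₀ r₁ A` (closed in the MODEL letters `(d, L, M_φ, M_φ′, M_τ, C_τ, a, a′, ϱ, ρ_w)`) BEFORE every height
# `n`, spacing `η` (`ηL^{n+1} = 1`), weights (`c₀(L^{n+1})^d = c₁`), lattice `m` and background `U` in the small-field window `‖U(b) − 1‖ ≤ αη`, `‖U(∂p) − 1‖ ≤ αη²`,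
# `‖Ū^j(b) − 1‖ ≤ ε_j ≤ αϱ^j`, `α ≤ α₀`: `‖P_{y₁} ∘ G₁,k(U) ∘ P_{y₀}‖ ≤ A·e^{−r₁·d_m(y₀,y₁)}`** — this lineage's `∃ r₀`-first row
# `B9Eq326DeltaABlockDecayTowerClosedRadius` (over the OWNER's (HQKT) `norm_block_G1k_le_closed`) with its letter binders INHABITED by
# `B9Eq3126H1RowLettersDiagonalClosed` (`γ` — OWNER; `hpos′`, `κ₁` — KAPPA1; `γ′` — OWNER; `M` — the tower `Q̃′_k` letters; the curvature letter —
# `B9Ineq369CurvatureSmall`): NO letter displayed but print's running axioms — the END of road ΔA-CT for `G₁` (the `G₁` twin of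
# `B9Eq3126H1BlockDecayTowerDiagonalClosed`)

statement-level skeleton of published theorems with citation tags; proofs where landed; nothing here is a claim about the Yang–Mills mass gap

CITATION HEADER (lean-in-tree rule).  Audit cell `pub-balaban`, sub-cell `t4`, BINDER row NE9 (road ΔA-CT of the NE9 formalisation swarm, leaf prover 03
`b2b-balaban-t4-ne9-formalise-leaf-03` gen 77).  Imports BY NAME this lineage's `B9Eq326DeltaABlockDecayTowerClosedRadius` (`exists_rate_block_decay_G1k_closed`;
through it the OWNER t4-ne9-p1's (HQKT) chain, (GBT2), (PDCT), (CRWT)) and `B9Eq3126H1RowLettersDiagonalClosed` (`exists_H1_row_letters_diagonal_closed`).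
Sources READ first-hand: [Balaban1985BackgroundPropagators] (`paper:balaban1985-cmp99-background-propagators`, journal page = PDF page + 388) p. 395 (3.26), p. 416
Thm 3.11, p. 406 (3.79), p. 399 (3.49), p. 396 (3.35)–(3.37).  Print: random walk, kernel bound, «O(1)»; the cell: Combes–Thomas on `L²` blocks, crude closed
constants — an `L²`-operator SHADOW of (3.49) for `G = Δ_a⁻¹`, uniform in the height, NOT the pointwise kernel bound.

WHAT IS PROVED (sorry-free; proof lane — no `def`; [folklore] composition BY NAME).
* **`exists_block_decay_G1k_diagonal_closed`** — for `1 ≤ d`, `3 ≤ L`, the fibre ∕ trace letters, `a, a′ > 0`, `0 ≤ ϱ < 1`, `ρ_w ≥ 0`: `∃ α₀ r₁ A`, `0 < α₀`,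
  `0 < r₁`, `0 ≤ A`, such that for every `n`, `η` (`ηL^{n+1} = 1`), `c₀, c₁` (`c₀(L^{n+1})^d = c₁`, `|η|^d∕c₀ ≤ ρ_w`), `m` (`1 ≤ m_i`), `U` with E162's data, level
  windows `ε_j` and level unit ball, `0 ≤ α ≤ α₀`, unitary, `U(b) ∈ U1`, `‖U(b) − 1‖ ≤ αη`, `‖U(∂p) − 1‖ ≤ αη²`, `ε_j ≤ αϱ^j`, ANY positivity witness `hpos`
  of `Δ_{a,k}(U)`, the block family `P_y`: `‖P_{y₁} ∘ G₁,k(U) ∘ P_{y₀}‖ ≤ A·exp(−r₁·d_m(y₀,y₁))` (`r₁ = r₀`, `A = (4∕γ)e^{r₀}`).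
HONEST SCOPE.  Composition; crude constants; `L²` block-operator decay only (NOT the kernel bound (3.49), NOT print's `δ₀`); the running axioms stay displayed;
NOT NE9 (cell pub-balaban: NE9 NOT PRINTED ∕ NOT PROVED; «NE9 ⇐ the named binders»; row WALLED ON A MODEL (O-NE9-1; #5 UNRULED); spine PROVED 0∕9; rung (B)+1 on a
finite T⁴ — NOT infinite volume, NOT mass gap, NOT BetaPertH, NOT Clay; HONEST DEPENDENCY: continuum YM on T⁴ ⇐ BetaPertH ∧ nine spine estimates (0/9 proved);
BetaPertH ⇐ (D1) ∧ (D4) ∧ CAP+tail; G-an2-4 gates asym, D1 and NE2/3/4).  NEW file; nothing modified.  Net new unproved facts: 0.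
-/

noncomputable section

set_option autoImplicit false

open scoped InnerProductSpace ComplexConjugate BigOperators
open NormedSpace

namespace Literature.MathematicalPhysics.QuantumFieldTheory.Balaban1983to89.B9Eq326DeltaABlockDecayTowerDiagonalClosed

open B4Sect5Torus (TSite tdist)
open B4Sect5Proof (latticeConst)
open B9SectCLatticeCarrier (Bond DirPair bpos btgt)
open B9Eq311L2Pairing (WL2)
open B9Eq319QprimeTorus (fineP blockCoord)
open B9Eq315QTower (towerP UlevOf)
open B9Eq315QTorus (perCfg cornerSite)
open B7Prop1Explicit (U1 Wcx boxVec)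
open B9Eq316TowerFlatIsOneStep (siteCast towerP_eq_fineP_pow)
open B11Eq103H1Complex (SiteL2K BondL2K)
open B9Eq310DeltaPrime (plaqHolU)
open B9Eq310HessianOperator (adTransportW)
open B9Eq310HessianHermitian (adTransportW_adjoint)
open B9Eq326OperatorTower (laplaceAk G1k QkW)
open B9Eq326DeltaABlockDecayTowerClosedRadius (exists_rate_block_decay_G1k_closed)
open B9Eq3126H1RowLettersDiagonalClosed (exists_H1_row_letters_diagonal_closed)

variable {d : ℕ} (hd : 1 ≤ d) (L : ℕ) [NeZero L] (hL : 1 ≤ L) (hL3 : 3 ≤ L)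
  {𝔸 : Type*} [NormedRing 𝔸] [NormedAlgebra ℂ 𝔸] [CompleteSpace 𝔸] [NormOneClass 𝔸] [StarRing 𝔸] [NormedStarGroup 𝔸] [StarModule ℂ 𝔸]
  {W : Type*} [NormedAddCommGroup W] [InnerProductSpace ℂ W] [FiniteDimensional ℂ W] (φ : W ≃ₗ[ℂ] 𝔸)
  {Mφ Mφ' : ℝ} (hMφ : 0 ≤ Mφ) (hMφ' : 0 ≤ Mφ') (hφ : ∀ w, ‖φ w‖ ≤ Mφ * ‖w‖) (hφ' : ∀ X, ‖φ.symm X‖ ≤ Mφ' * ‖X‖) (hstar : ∀ X : 𝔸, ‖star X‖ ≤ ‖X‖)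
  {a : ℝ} (ha : 0 < a) {a' : ℝ} (ha' : 0 < a') {ϱ : ℝ} (hϱ0 : 0 ≤ ϱ) (hϱ1 : ϱ < 1)
  (τ : 𝔸 →ₗ[ℂ] ℂ) {Cτ : ℝ} (hτ : ∀ X, ‖τ X‖ ≤ Cτ * ‖X‖) (hCτ : 0 ≤ Cτ) {Mτ : ℝ} (hτm : ∀ X Y : 𝔸, ‖τ (X * Y)‖ ≤ Mτ * ‖X‖ * ‖Y‖) (hMτ : 0 ≤ Mτ)
  {ρw : ℝ} (hρw : 0 ≤ ρw)
  (hτ₁ : ∀ X : 𝔸, τ (star X) = conj (τ X)) (hτ₂ : ∀ X Y : 𝔸, τ (X * Y) = τ (Y * X)) (hφτ : ∀ X Y : 𝔸, ⟪φ.symm X, φ.symm Y⟫_ℂ = τ (star X * Y))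

set_option maxHeartbeats 800000 in
include hd hL hL3 hMφ hMφ' hφ hφ' hstar ha ha' hϱ0 hϱ1 hτ hCτ hτm hMτ hρw hτ₁ hτ₂ hφτ in
/-- **THE `L²` BLOCK DECAY OF `G₁,k(U)` ON THE DIAGONAL, FULLY CLOSED — `∃ α₀ r₁ A` BEFORE `∀ n η c₀ c₁ m U`.**  `exists_rate_block_decay_G1k_closed` at the
letters of `exists_H1_row_letters_diagonal_closed` (`γ, hpos′, γ′, κ₁, M`, the curvature letter at `δ := αη²`, `ε_s := α₀`, `p_K⁰ := 768·|DirPair d|·M_τM_φ²ρ_w·α₀ <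
γ∕2`), `hRS` from unitarity; rate `r₁ = r₀`, constant `A = (4∕γ)e^{r₀}`. [cite: Balaban1985BackgroundPropagators, (3.26) p.395, Thm 3.11 p.416, (3.79) p.406,
(3.49) p.399, (3.35)–(3.37) p.396] -/
theorem exists_block_decay_G1k_diagonal_closed :
    ∃ α₀ r₁ A : ℝ, 0 < α₀ ∧ 0 < r₁ ∧ 0 ≤ A ∧
      ∀ (n : ℕ) (η : ℝ) (_hηL : η * (L : ℝ) ^ (n + 1) = 1) (c₀ c₁ : ℝ) [Fact (0 < c₀)] [Fact (0 < c₁)]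
        (_hw : c₀ * ((L : ℝ) ^ (n + 1)) ^ d = c₁) (_hρ : |η| ^ d / c₀ ≤ ρw) (m : Fin d → ℕ) [∀ i, NeZero (m i)] (_hm : ∀ i, 1 ≤ m i)
        (U : Bond d (towerP L m (n + 1)) → 𝔸ˣ) (αU : ℕ → ℝ) (_hα0 : ∀ j, 0 ≤ αU j) (hα1 : ∀ j, αU j ≤ 1 / 64)
        (hU1 : ∀ (j : ℕ) (x : B7Prop1Explicit.Site d) (k : Fin d), perCfg (towerP L m (j + 1)) (UlevOf L m (n + 1) U j) x k ∈ U1 𝔸)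
        (hreg : ∀ (j : ℕ) (y : TSite d (towerP L m j)) (k : Fin d) (ρ' : Fin d → Fin L),
          ‖((Wcx L (perCfg (towerP L m (j + 1)) (UlevOf L m (n + 1) U j)) (cornerSite L y) k (boxVec L ρ') : 𝔸ˣ) : 𝔸) - 1‖ ≤ αU j)
        (εU : ℕ → ℝ) (_hεU : ∀ j, 0 ≤ εU j) (_hUε : ∀ (j : ℕ) (b : Bond d (towerP L m (j + 1))), ‖(UlevOf L m (n + 1) U j b : 𝔸) - 1‖ ≤ εU j)
        (_hLb : ∀ (j : ℕ) (b : Bond d (towerP L m (j + 1))), UlevOf L m (n + 1) U j b ∈ U1 𝔸)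
        (α : ℝ) (_hα : 0 ≤ α) (_hαle : α ≤ α₀)
        (_hUst : ∀ b, star (U b : 𝔸) = (((U b)⁻¹ : 𝔸ˣ) : 𝔸)) (_hUb : ∀ b, U b ∈ U1 𝔸) (_hUη : ∀ b, ‖(U b : 𝔸) - 1‖ ≤ α * η)
        (_hpl : ∀ p : B9SectCLatticeCarrier.Plaq d (towerP L m (n + 1)), ‖(plaqHolU U p : 𝔸) - 1‖ ≤ α * η ^ 2)
        (_hεg : ∀ j < n + 1, εU j ≤ α * ϱ ^ j)
        (hpos : ∀ x : BondL2K ℂ d (towerP L m (n + 1)) c₀ W, x ≠ 0 →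
          0 < RCLike.re ⟪x, laplaceAk L m n φ η U hL αU hα1 hU1 hreg τ (c₀ := c₀) (c₁ := c₁) a x⟫_ℂ)
        (PB : TSite d m → BondL2K ℂ d (towerP L m (n + 1)) c₀ W →L[ℂ] BondL2K ℂ d (towerP L m (n + 1)) c₀ W)
        (_hPB : ∀ (y : TSite d m) (f : BondL2K ℂ d (towerP L m (n + 1)) c₀ W) (b : Bond d (towerP L m (n + 1))),
          WL2.equiv ℂ (fun _ : Bond d (towerP L m (n + 1)) => c₀) W (PB y f) b =
            if blockCoord (L ^ (n + 1)) m (siteCast (towerP_eq_fineP_pow L m (n + 1)) (bpos b)) = y then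
              WL2.equiv ℂ (fun _ : Bond d (towerP L m (n + 1)) => c₀) W f b else 0)
        (y₀ y₁ : TSite d m),
        ‖PB y₁ ∘L LinearMap.toContinuousLinearMap (G1k L m n φ η U hL αU hα1 hU1 hreg τ (c₀ := c₀) (c₁ := c₁) hpos) ∘L PB y₀‖ ≤
          A * Real.exp (-(r₁ * tdist m y₀ y₁)) := by
  have hL2 : 2 ≤ L := le_trans (by norm_num) hL3
  -- the six letters, closed in one window
  obtain ⟨α₀, γ, μ₁, γ', κ₁, M, hα₀, hγ, -, -, hγ', hγ'1, hκ₁, hM, hgap, HL⟩ :=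
    exists_H1_row_letters_diagonal_closed hd L hL hL3 φ hMφ hMφ' hφ hφ' ha ha' hϱ0 hϱ1 τ hτ hCτ hρw hτ₁ hτ₂ hφτ hMτ
  have hP0 : 0 ≤ 768 * Fintype.card (DirPair d) * Mτ * Mφ ^ 2 * ρw * α₀ := by positivity
  -- the radius, chosen once
  obtain ⟨r₀, -, hr₀, HE⟩ := exists_rate_block_decay_G1k_closed L hL2 φ hφ hφ' hMφ hMφ' hstar τ hτm hMτ a ha.le ha'.le hϱ0 hϱ1 hα₀.le hγ' hγ'1 hκ₁ hM
    hγ hP0 hgap d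
  refine ⟨α₀, r₀, 4 / γ * Real.exp r₀, hα₀, hr₀, by positivity, ?_⟩
  intro n η hηL c₀ c₁ _ _ hw hρ m _ hm U αU hαU0 hα1 hU1 hreg εU hεU hUε hLb α hα hαle hUst hUb hUη hpl hεg hpos PB hPB y₀ y₁
  obtain ⟨hcoer, -, hpos', coercive, hκ, hMQ, hRe, hIm, hpK⟩ :=
    HL n η hηL c₀ c₁ hw hρ m U αU hα1 hU1 hreg εU hεU hUε hLb hα hαle hUst hUb hUη hpl hεg
  have hRS : ∀ (b : Bond d (towerP L m (n + 1))) (v u : W), ⟪adTransportW φ U b v, u⟫_ℂ = ⟪v, adTransportW φ (fun b => (U b)⁻¹) b u⟫_ℂ :=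
    adTransportW_adjoint φ τ hτ₂ hUst hφτ
  have hη : 0 < η := by
    have hLp : (0 : ℝ) < (L : ℝ) ^ (n + 1) := by positivity
    by_contra h
    have : η * (L : ℝ) ^ (n + 1) ≤ 0 := mul_nonpos_of_nonpos_of_nonneg (not_lt.mp h) hLp.le
    linarith
  have hεg' : ∀ j < n + 1, εU j ≤ α₀ * ϱ ^ j := fun j hj => (hεg j hj).trans (mul_le_mul_of_nonneg_right hαle (pow_nonneg hϱ0 j))
  have hδ : 0 ≤ α * η ^ 2 := by positivity
  exact HE n η hη hηL c₀ c₁ hw m hm U hUb hRS αU hαU0 hα1 hU1 hreg εU hεU hUε hεg' (α * η ^ 2) hδ hRe hIm hpK hpos' coercive (hκ hpos') hMQ hpos hcoer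
    PB hPB y₀ y₁

end Literature.MathematicalPhysics.QuantumFieldTheory.Balaban1983to89.B9Eq326DeltaABlockDecayTowerDiagonalClosed

end
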